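/-
Copyright: statement-level skeleton of a published paper (lit-balaban cell, Phase-2 proof seat p25, gen 20). No proof
claims beyond what the kernel checks below.
-/
import Mathlib.Analysis.Matrix.Normed
import Mathlib.Analysis.Matrix.PosDef
import Literature.MathematicalPhysics.QuantumFieldTheory.BalabanImbrieJaffe1984to88.BIJ88PolymerRep5134Gauss

/-!
# `BalabanImbrieJaffe1984to88.BIJ88WalkCovarianceSplit310` — T. Bałaban, J. Imbrie, A. Jaffe, *Effective action and
cluster properties of the abelian Higgs model*, Commun. Math. Phys. **114** (1988) 257–315 [BalabanImbrieJaffe1988],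
§5.14 p. 310 [PDF 54], verbatim (x2 render `lit-balaban-r16/renders/cmp114/original-p054-x2.png`, re-read this session):
*"We give random walk expansions for the propagators C^{(k)}_{Λ₁₂^{(k)}}, C^{(k)}_{Λ₁₂^{(k)}}(u_{k+1}) produced in this
step. The leading terms, with only propagators C^{(k)}_{Λ₁₂^{(k)},loc}, C^{(k)}_{Λ₁₂^{(k)},loc}(u_{k+1}), we transform
further. The others, localized in region X, have a factor of e^{−cr(e_k)|X|}."* and *"we define C^{(k)}_{Λ,loc} by cutting
off the kernel when the arguments are separated by O(r(e_k))."* — **THE COVARIANCE SPLIT OF THE REMAINDER EXPANSION ON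
THE MODEL OF RECORD: THE R-STEP RANDOM-WALK (BLOCK-NEUMANN) IDENTITY** (p25 gen 20; a MEMBER of row C2.Claim@312 —
the head theorem `BIJ88WalkIneq312RemainderBdry.ineq312_remainder_bdry` takes an ABSTRACT finite family of covariance
pieces `Cov p` (local pieces: brackets `≤ B_ℓ`; "walk" pieces: brackets `≤ θ_w·θ^{#reg p}`), its clause C1; this file
CONSTRUCTS such a family for the §5.13 law).

For a real matrix `A` indexed by sites carrying cube labels `b : n → I` (the model: `A = prec blk Δ W 1_W = Δ|_W`,
`BIJ88PolymerRep5134Gauss.prec_ind_self`, `b x = blk x`): `D := blockDiag b A` (the cube-diagonal blocks), `N := D − A`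
(the inter-cube couplings, `offDiag`), `T := D⁻¹N` (one random-walk step from a cube to a Δ-coupled cube, `stepOp`),
  `C_{loc,R} := (Σ_{k<R} T^k) D⁻¹`  (`locPiece`),   `C_{tail,R} := T^R A⁻¹`  (`tailPiece`).
* §1 `blockDiag_sub_offDiag` (`A = D − N`), `isHermitian_blockDiag`, **`posDef_blockDiag`** (`A ≻ 0 ⇒ D ≻ 0`: the
  quadratic form of `D` is the sum of the forms of `A` on the cube restrictions), `inv_blockDiag_apply_of_ne` (`D⁻¹` is
  cube-block-diagonal: `D · blockDiag(D⁻¹) = 1`);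
* §2 **`locPiece_add_tailPiece`** — THE IDENTITY `C_{loc,R} + C_{tail,R} = A⁻¹` for every `R` (`T^k D⁻¹ = (T^k − T^{k+1})A⁻¹`
  telescoped; `A`, `D` invertible);
* §3 RANGE — *"cutting off the kernel when the arguments are separated by O(r(e_k))"*: with `CubeWalk adj k i j` (a chain
  of `k` `adj`-steps between cubes) and the locality of `A` (`A x y = 0` unless `b x = b y` or `adj (b x) (b y)` — the
  §5.13 model's standing hypothesis on `Δ`), `stepOp_apply_ne_zero` (`T x y ≠ 0 ⇒ adj (b x) (b y)`),
  `stepOp_pow_apply_ne_zero`, **`locPiece_apply_eq_zero`** (`C_{loc,R}(x,y) = 0` unless `b y` is reached from `b x` by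
  FEWER THAN `R` steps), `tailPiece_eq_stepOp_pow_mul`;
* §4 SIZES in the `ℓ^∞`-operator norm (Mathlib `Matrix.Norms.Operator`, matched to the sup norm of the head's
  directions): `norm_locPiece_le` (`≤ (Σ_{k<R}‖T^k‖)·‖D⁻¹‖`), `norm_tailPiece_le` (`≤ ‖T^R‖·‖A⁻¹‖` — print's
  `e^{−cr(e_k)}`: the smallness of `‖T^R‖` is the model's decay input, NOT derived here), `abs_mulVec_dotProduct_le`
  (`|(Mu)·w| ≤ ‖M‖‖u‖_∞ Σ|w|`), `norm_mulVec_le'`;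
* §5 THE MODEL: `covSplit blk Δ W R : Bool → Matrix` (`false ↦ C_{loc,R}`, `true ↦ C_{tail,R}` of `prec blk Δ W 1_W`),
  **`sum_covSplit`** (`Σ_p covSplit p = prec⁻¹` — the hypothesis `hCov` of `BIJ88WalkLocatedDisplay312.located_display_fieldLaw`
  DISCHARGED, stated with the classical `DecidableEq` as there), `covSplit_false_apply_eq_zero` (range `< R` cubes under the
  model's `Δ`-locality `hΔ`).

statement-level skeleton of published theorems with citation tags; proofs where landed; nothing here is a claim
about the Yang–Mills mass gap

PDF held: `paper:balaban1988-cmp114-bij-abelian-higgs-effective-action` (journal page = PDF page + 256); p. 310 = PDF 54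
(x2 render re-read this session, 2026-08-23).

CITATION HEADER (lean-in-tree rule).  lit-balaban cell (HOME `run/shared/lean/pub/lit-balaban/`), Phase 2, seat p25
gen 20; row **C2.Claim@312** of `HOME/lit-balaban-r16/ROWS-C2-part2.md` (owner r16, referee ref-5; head theorem of
record v2.284 UNCHANGED; this file is a MEMBER serving clause C1 — covariance pieces / locality — ON THE MODEL OF
RECORD).  USED BY NAME, nothing restated: `BIJ88PolymerRep5134Gauss.{prec, prec_ind_self}`, `BIJ88PolymerRep5134.corner`.
HONEST SCOPE: (a) the split is by WALK LENGTH in cube steps (`R` ↔ print's `O(r(e_k))` measured in elementary cubes),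
print cuts off by distance — the same object up to the choice of metric; (b) ONE tail piece (print indexes the non-local
walks by their localization regions `X` with `e^{−cr(e_k)|X|}`; no region bookkeeping here: in the head `reg ≡ ∅` for the
tail); (c) the smallness of `‖T^R‖` (print's `e^{−cr(e_k)}`) and the size of `‖D⁻¹‖`, `‖A⁻¹‖` are NOT derived — they are
the decay inputs of the lattice propagators ([Balaban1983RegularityDecay]-type estimates), left as the numbers they are;
(d) exact finite identities only, no series.  NOT summit progress; NOT continuum; NOT Clay.  Imports `Mathlib.Analysis.Matrix.Normed`, `Mathlib.Analysis.Matrix.PosDef`,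
`BIJ88PolymerRep5134Gauss`; modifies nothing.
-/

noncomputable section

namespace Literature.MathematicalPhysics.QuantumFieldTheory.BalabanImbrieJaffe1984to88.BIJ88WalkCovarianceSplit310

open Matrix Finset
open scoped BigOperators Matrix.Norms.Operator

/-! ## §1  Cube-block-diagonal part and inter-cube part -/

section Generic

variable {n I : Type} [DecidableEq I] (b : n → I)

/-- `D = blockDiag b A`: the cube-diagonal blocks of `A` (`D(x,y) = A(x,y)` if `x`, `y` lie in the same cube, else `0`).
[cite: BalabanImbrieJaffe1988, §5.14 p.310] -/
def blockDiag (A : Matrix n n ℝ) : Matrix n n ℝ := Matrix.of fun x y => if b x = b y then A x y else 0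

/-- `N = D − A`: minus the inter-cube couplings. [cite: BalabanImbrieJaffe1988, §5.14 p.310] -/
def offDiag (A : Matrix n n ℝ) : Matrix n n ℝ := blockDiag b A - A

/-- the restriction of a vector to the cube `i`. [cite: BalabanImbrieJaffe1988, §5.14 p.310] -/
def cubePart (v : n → ℝ) (i : I) : n → ℝ := fun x => if b x = i then v x else 0

variable {b} {A : Matrix n n ℝ}

/-- [cite: BalabanImbrieJaffe1988, §5.14 p.310] -/
theorem blockDiag_apply (A : Matrix n n ℝ) (x y : n) : blockDiag b A x y = if b x = b y then A x y else 0 := rfl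

/-- `D` vanishes between different cubes. [cite: BalabanImbrieJaffe1988, §5.14 p.310] -/
theorem blockDiag_apply_of_ne (A : Matrix n n ℝ) {x y : n} (h : b x ≠ b y) : blockDiag b A x y = 0 := by
  rw [blockDiag_apply, if_neg h]

/-- `A = D − N`. [cite: BalabanImbrieJaffe1988, §5.14 p.310] -/
theorem blockDiag_sub_offDiag (A : Matrix n n ℝ) : blockDiag b A - offDiag b A = A := sub_sub_cancel _ _

/-- `N` vanishes inside a cube and equals `−A` between cubes. [cite: BalabanImbrieJaffe1988, §5.14 p.310] -/
theorem offDiag_apply (A : Matrix n n ℝ) (x y : n) : offDiag b A x y = if b x = b y then 0 else -A x y := by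
  simp only [offDiag, Matrix.sub_apply, blockDiag_apply]
  split_ifs <;> ring

/-- `D` is symmetric when `A` is. [cite: BalabanImbrieJaffe1988, §5.14 p.310] -/
theorem isHermitian_blockDiag (hA : A.IsHermitian) : (blockDiag b A).IsHermitian := by
  refine Matrix.IsHermitian.ext fun x y => ?_
  have h := hA.apply x y
  simp only [blockDiag_apply, star_trivial] at h ⊢
  by_cases hxy : b x = b y
  · rw [if_pos hxy, if_pos hxy.symm, h]
  · rw [if_neg hxy, if_neg (Ne.symm hxy)]

variable [Fintype n]

/-- THE QUADRATIC FORM OF `D` IS THE SUM OVER CUBES OF THE FORM OF `A` ON THE CUBE RESTRICTIONS: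
`v·Dv = Σ_{i} (v|_i)·A(v|_i)`. [cite: BalabanImbrieJaffe1988, §5.14 p.310] -/
theorem dotProduct_blockDiag_mulVec (A : Matrix n n ℝ) (v : n → ℝ) :
    v ⬝ᵥ (blockDiag b A *ᵥ v) = ∑ i ∈ univ.image b, cubePart b v i ⬝ᵥ (A *ᵥ cubePart b v i) := by
  simp only [dotProduct, mulVec, blockDiag_apply, cubePart]
  -- both sides as a double sum over sites
  have hR : ∀ i ∈ univ.image b, ∑ x, (if b x = i then v x else 0) * ∑ y, A x y * (if b y = i then v y else 0)
      = ∑ x, ∑ y, if b x = i ∧ b y = i then v x * (A x y * v y) else 0 := by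
    intro i _
    refine Finset.sum_congr rfl fun x _ => ?_
    rw [Finset.mul_sum]
    refine Finset.sum_congr rfl fun y _ => ?_
    by_cases hx : b x = i <;> by_cases hy : b y = i <;> simp [hx, hy]
  rw [Finset.sum_congr rfl hR, Finset.sum_comm]
  refine Finset.sum_congr rfl fun x _ => ?_
  rw [Finset.mul_sum, Finset.sum_comm]
  refine Finset.sum_congr rfl fun y _ => ?_
  by_cases hxy : b x = b y
  · have hfil : (univ.image b).filter (fun i => b x = i ∧ b y = i) = {b x} := by
      ext i; simp only [mem_filter, mem_image, mem_univ, true_and, mem_singleton]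
      constructor
      · rintro ⟨-, h1, -⟩; exact h1.symm
      · rintro rfl; exact ⟨⟨x, rfl⟩, rfl, hxy.symm⟩
    rw [if_pos hxy]
    symm
    calc ∑ i ∈ univ.image b, (if b x = i ∧ b y = i then v x * (A x y * v y) else 0)
        = ∑ i ∈ (univ.image b).filter (fun i => b x = i ∧ b y = i), v x * (A x y * v y) :=
          (Finset.sum_filter _ _).symm
      _ = v x * (A x y * v y) := by rw [hfil, sum_singleton]
  · rw [if_neg hxy, zero_mul, mul_zero]
    symm
    refine Finset.sum_eq_zero fun i _ => ?_
    rw [if_neg]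
    rintro ⟨h1, h2⟩; exact hxy (h1.trans h2.symm)

/-- **`A ≻ 0 ⇒ D ≻ 0`** (so `D⁻¹` exists): a nonzero `v` has a nonzero cube restriction `v|_i`, whose `A`-form is
positive, and all the others are nonnegative. [cite: BalabanImbrieJaffe1988, §5.14 p.310] -/
theorem posDef_blockDiag (hA : A.PosDef) : (blockDiag b A).PosDef := by
  refine Matrix.PosDef.of_dotProduct_mulVec_pos (isHermitian_blockDiag hA.isHermitian) fun v hv => ?_
  rw [star_trivial, dotProduct_blockDiag_mulVec]
  obtain ⟨x, hx⟩ : ∃ x, v x ≠ 0 := by simpa only [Pi.zero_apply] using Function.ne_iff.1 hv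
  have hne : cubePart b v (b x) ≠ 0 := by
    intro h; have h' := congr_fun h x; simp only [cubePart, if_true, Pi.zero_apply] at h'; exact hx h'
  refine Finset.sum_pos' (fun i _ => ?_) ⟨b x, mem_image_of_mem _ (mem_univ x), ?_⟩
  · simpa only [star_trivial] using hA.posSemidef.dotProduct_mulVec_nonneg (cubePart b v i)
  · simpa only [star_trivial] using hA.dotProduct_mulVec_pos hne

/-- the sup norm of `Mu` against the `ℓ^∞`-operator norm: `‖Mu‖_∞ ≤ ‖M‖·‖u‖_∞`.
[cite: BalabanImbrieJaffe1988, §5.14 p.310] -/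
theorem norm_mulVec_le' (M : Matrix n n ℝ) (u : n → ℝ) : ‖M *ᵥ u‖ ≤ ‖M‖ * ‖u‖ := Matrix.linfty_opNorm_mulVec _ _

/-- a bracket against the sup norm and the `ℓ¹` mass: `|a·w| ≤ ‖a‖_∞ · Σ_x |w x|`.
[cite: BalabanImbrieJaffe1988, §5.14 p.310] -/
theorem abs_dotProduct_le_norm_mul_sum (a w : n → ℝ) : |a ⬝ᵥ w| ≤ ‖a‖ * ∑ x, |w x| := by
  rw [dotProduct, Finset.mul_sum]
  refine (Finset.abs_sum_le_sum_abs _ _).trans (Finset.sum_le_sum fun x _ => ?_)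
  rw [abs_mul]
  exact mul_le_mul_of_nonneg_right (by simpa only [Real.norm_eq_abs] using norm_le_pi_norm a x) (abs_nonneg _)

/-- **THE BRACKET BOUND**: `|(Mu)·w| ≤ ‖M‖·‖u‖_∞·Σ_x|w x|`. [cite: BalabanImbrieJaffe1988, §5.14 p.310] -/
theorem abs_mulVec_dotProduct_le (M : Matrix n n ℝ) (u w : n → ℝ) :
    |(M *ᵥ u) ⬝ᵥ w| ≤ ‖M‖ * ‖u‖ * ∑ x, |w x| :=
  (abs_dotProduct_le_norm_mul_sum _ _).trans
    (mul_le_mul_of_nonneg_right (norm_mulVec_le' M u) (Finset.sum_nonneg fun _ _ => abs_nonneg _))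

/-! ## §2  One random-walk step, the R-step identity -/

variable [DecidableEq n] (b)

/-- `T = D⁻¹N`: one random-walk step (a cube-internal propagation followed by one inter-cube coupling).
[cite: BalabanImbrieJaffe1988, §5.14 p.310] -/
def stepOp (A : Matrix n n ℝ) : Matrix n n ℝ := (blockDiag b A)⁻¹ * offDiag b A

/-- `C_{loc,R} = (Σ_{k<R} T^k) D⁻¹`: the walks of fewer than `R` steps — *"C^{(k)}_{Λ,loc} by cutting off the kernel"*.
[cite: BalabanImbrieJaffe1988, §5.14 p.310] -/
def locPiece (A : Matrix n n ℝ) (R : ℕ) : Matrix n n ℝ := (∑ k ∈ range R, stepOp b A ^ k) * (blockDiag b A)⁻¹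

/-- `C_{tail,R} = T^R A⁻¹`: the walks of at least `R` steps — *"The others … have a factor of e^{−cr(e_k)|X|}"*.
[cite: BalabanImbrieJaffe1988, §5.14 p.310] -/
def tailPiece (A : Matrix n n ℝ) (R : ℕ) : Matrix n n ℝ := stepOp b A ^ R * A⁻¹

variable {b}

/-- `D·blockDiag(D⁻¹) = 1`: the cube-block truncation of `D⁻¹` is a right inverse of `D` (`D` invertible), HENCE `D⁻¹`
ITSELF IS CUBE-BLOCK-DIAGONAL. [cite: BalabanImbrieJaffe1988, §5.14 p.310] -/
theorem blockDiag_mul_blockDiag_inv (hD : IsUnit (blockDiag b A).det) :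
    blockDiag b A * blockDiag b ((blockDiag b A)⁻¹) = 1 := by
  have h1 : blockDiag b A * (blockDiag b A)⁻¹ = 1 := mul_nonsing_inv _ hD
  ext x y
  have hxy := congr_fun (congr_fun h1 x) y
  simp only [mul_apply, blockDiag_apply] at hxy ⊢
  by_cases h : b x = b y
  · rw [← hxy]
    refine Finset.sum_congr rfl fun z _ => ?_
    by_cases hz : b x = b z
    · rw [if_pos hz, if_pos (hz.symm.trans h)]
    · rw [if_neg hz, zero_mul, zero_mul]
  · rw [Matrix.one_apply_ne (fun hxy' => h (congrArg b hxy'))]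
    refine Finset.sum_eq_zero fun z _ => ?_
    by_cases hz : b x = b z
    · rw [if_pos hz, if_neg (fun hzy => h (hz.trans hzy)), mul_zero]
    · rw [if_neg hz, zero_mul]

/-- **`D⁻¹` IS CUBE-BLOCK-DIAGONAL**: `D⁻¹(x,y) = 0` for `x`, `y` in different cubes.
[cite: BalabanImbrieJaffe1988, §5.14 p.310] -/
theorem inv_blockDiag_apply_of_ne (hD : IsUnit (blockDiag b A).det) {x y : n} (h : b x ≠ b y) :
    (blockDiag b A)⁻¹ x y = 0 := by
  rw [Matrix.inv_eq_right_inv (blockDiag_mul_blockDiag_inv hD), blockDiag_apply_of_ne _ h]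

/-- `D·T = N`. [cite: BalabanImbrieJaffe1988, §5.14 p.310] -/
theorem blockDiag_mul_stepOp (hD : IsUnit (blockDiag b A).det) : blockDiag b A * stepOp b A = offDiag b A := by
  rw [stepOp, ← mul_assoc, mul_nonsing_inv _ hD, one_mul]

/-- `D⁻¹A = 1 − T`. [cite: BalabanImbrieJaffe1988, §5.14 p.310] -/
theorem inv_blockDiag_mul (hD : IsUnit (blockDiag b A).det) : (blockDiag b A)⁻¹ * A = 1 - stepOp b A := by
  calc (blockDiag b A)⁻¹ * A = (blockDiag b A)⁻¹ * (blockDiag b A - offDiag b A) := by rw [blockDiag_sub_offDiag]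
    _ = 1 - stepOp b A := by rw [mul_sub, nonsing_inv_mul _ hD, stepOp]

/-- `D⁻¹ = (1 − T)A⁻¹`. [cite: BalabanImbrieJaffe1988, §5.14 p.310] -/
theorem inv_blockDiag_eq (hA : IsUnit A.det) (hD : IsUnit (blockDiag b A).det) :
    (blockDiag b A)⁻¹ = (1 - stepOp b A) * A⁻¹ := by
  calc (blockDiag b A)⁻¹ = (blockDiag b A)⁻¹ * (A * A⁻¹) := by rw [mul_nonsing_inv _ hA, mul_one]
    _ = (1 - stepOp b A) * A⁻¹ := by rw [← mul_assoc, inv_blockDiag_mul hD]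

/-- one telescoping step: `T^k D⁻¹ = T^k A⁻¹ − T^{k+1} A⁻¹`. [cite: BalabanImbrieJaffe1988, §5.14 p.310] -/
theorem stepOp_pow_mul_inv_blockDiag (hA : IsUnit A.det) (hD : IsUnit (blockDiag b A).det) (k : ℕ) :
    stepOp b A ^ k * (blockDiag b A)⁻¹ = stepOp b A ^ k * A⁻¹ - stepOp b A ^ (k + 1) * A⁻¹ := by
  rw [inv_blockDiag_eq hA hD, ← mul_assoc, mul_sub, mul_one, sub_mul, pow_succ]

/-- **THE R-STEP RANDOM-WALK IDENTITY** `C_{loc,R} + C_{tail,R} = A⁻¹`, i.e.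
`A⁻¹ = Σ_{k<R} (D⁻¹N)^k D⁻¹ + (D⁻¹N)^R A⁻¹` for every `R` (`A`, `D` invertible) — the propagator as the walks of fewer
than `R` cube-steps plus the remainder. [cite: BalabanImbrieJaffe1988, §5.14 p.310] -/
theorem locPiece_add_tailPiece (hA : IsUnit A.det) (hD : IsUnit (blockDiag b A).det) (R : ℕ) :
    locPiece b A R + tailPiece b A R = A⁻¹ := by
  rw [locPiece, tailPiece, Finset.sum_mul]
  simp_rw [stepOp_pow_mul_inv_blockDiag hA hD]
  rw [Finset.sum_range_sub' (fun k => stepOp b A ^ k * A⁻¹) R, pow_zero, one_mul, sub_add_cancel]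

/-- the same for a positive definite `A` (both `A` and `D` are then invertible).
[cite: BalabanImbrieJaffe1988, §5.14 p.310] -/
theorem locPiece_add_tailPiece_of_posDef (hA : A.PosDef) (R : ℕ) : locPiece b A R + tailPiece b A R = A⁻¹ :=
  locPiece_add_tailPiece hA.det_pos.ne'.isUnit (posDef_blockDiag hA).det_pos.ne'.isUnit R

/-! ## §3  Range: the local piece reaches fewer than `R` cubes away -/

/-- `CubeWalk adj k i j`: a chain of `k` `adj`-steps from cube `i` to cube `j`.
[cite: BalabanImbrieJaffe1988, §5.14 p.310] -/
def CubeWalk (adj : I → I → Prop) : ℕ → I → I → Prop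
  | 0, i, j => i = j
  | k + 1, i, j => ∃ m, CubeWalk adj k i m ∧ adj m j

variable {adj : I → I → Prop}

omit [Fintype n] [DecidableEq n] in
/-- `N(x,y) ≠ 0 ⇒` the cubes of `x`, `y` are distinct and `Δ`-coupled (under the locality of `A`).
[cite: BalabanImbrieJaffe1988, §5.14 p.310] -/
theorem offDiag_apply_ne_zero (hloc : ∀ x y, b x ≠ b y → ¬ adj (b x) (b y) → A x y = 0) {x y : n}
    (h : offDiag b A x y ≠ 0) : b x ≠ b y ∧ adj (b x) (b y) := by
  rw [offDiag_apply] at h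
  by_cases hxy : b x = b y
  · exact absurd (by rw [if_pos hxy]) h
  · rw [if_neg hxy, neg_ne_zero] at h
    exact ⟨hxy, by_contra fun hadj => h (hloc x y hxy hadj)⟩

/-- **ONE STEP MOVES TO A COUPLED CUBE**: `T(x,y) ≠ 0 ⇒ adj (b x) (b y)`. [cite: BalabanImbrieJaffe1988, §5.14 p.310] -/
theorem stepOp_apply_ne_zero (hD : IsUnit (blockDiag b A).det)
    (hloc : ∀ x y, b x ≠ b y → ¬ adj (b x) (b y) → A x y = 0) {x y : n} (h : stepOp b A x y ≠ 0) :
    adj (b x) (b y) := by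
  rw [stepOp, mul_apply] at h
  obtain ⟨z, -, hz⟩ := Finset.exists_ne_zero_of_sum_ne_zero h
  have h1 : (blockDiag b A)⁻¹ x z ≠ 0 := left_ne_zero_of_mul hz
  have h2 : offDiag b A z y ≠ 0 := right_ne_zero_of_mul hz
  have hxz : b x = b z := by_contra fun hne => h1 (inv_blockDiag_apply_of_ne hD hne)
  rw [hxz]
  exact (offDiag_apply_ne_zero hloc h2).2

/-- `T^k(x,y) ≠ 0 ⇒` a chain of `k` coupled-cube steps from `b x` to `b y`. [cite: BalabanImbrieJaffe1988, §5.14 p.310] -/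
theorem stepOp_pow_apply_ne_zero (hD : IsUnit (blockDiag b A).det)
    (hloc : ∀ x y, b x ≠ b y → ¬ adj (b x) (b y) → A x y = 0) :
    ∀ (k : ℕ) {x y : n}, (stepOp b A ^ k) x y ≠ 0 → CubeWalk adj k (b x) (b y)
  | 0, x, y, h => by
    rw [pow_zero] at h
    have hxy : x = y := by_contra fun hne => h (Matrix.one_apply_ne hne)
    exact congrArg b hxy
  | k + 1, x, y, h => by
    rw [pow_succ, mul_apply] at h
    obtain ⟨z, -, hz⟩ := Finset.exists_ne_zero_of_sum_ne_zero h
    exact ⟨b z, stepOp_pow_apply_ne_zero hD hloc k (left_ne_zero_of_mul hz),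
      stepOp_apply_ne_zero hD hloc (right_ne_zero_of_mul hz)⟩

/-- `(T^k D⁻¹)(x,y) ≠ 0 ⇒` a chain of `k` steps from `b x` to `b y` (`D⁻¹` does not leave the cube).
[cite: BalabanImbrieJaffe1988, §5.14 p.310] -/
theorem stepOp_pow_mul_inv_apply_ne_zero (hD : IsUnit (blockDiag b A).det)
    (hloc : ∀ x y, b x ≠ b y → ¬ adj (b x) (b y) → A x y = 0) (k : ℕ) {x y : n}
    (h : (stepOp b A ^ k * (blockDiag b A)⁻¹) x y ≠ 0) : CubeWalk adj k (b x) (b y) := by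
  rw [mul_apply] at h
  obtain ⟨z, -, hz⟩ := Finset.exists_ne_zero_of_sum_ne_zero h
  have hzy : b z = b y := by_contra fun hne => (right_ne_zero_of_mul hz) (inv_blockDiag_apply_of_ne hD hne)
  exact hzy ▸ stepOp_pow_apply_ne_zero hD hloc k (left_ne_zero_of_mul hz)

/-- **THE LOCAL PIECE HAS RANGE `< R` CUBES** — *"cutting off the kernel when the arguments are separated by O(r(e_k))"*:
`C_{loc,R}(x,y) = 0` unless `b y` is reached from `b x` by a chain of fewer than `R` coupled-cube steps.
[cite: BalabanImbrieJaffe1988, §5.14 p.310] -/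
theorem locPiece_apply_eq_zero (hD : IsUnit (blockDiag b A).det)
    (hloc : ∀ x y, b x ≠ b y → ¬ adj (b x) (b y) → A x y = 0) (R : ℕ) {x y : n}
    (hfar : ∀ k < R, ¬ CubeWalk adj k (b x) (b y)) : locPiece b A R x y = 0 := by
  rw [locPiece, Finset.sum_mul, Matrix.sum_apply]
  refine Finset.sum_eq_zero fun k hk => ?_
  by_contra h
  exact hfar k (mem_range.1 hk) (stepOp_pow_mul_inv_apply_ne_zero hD hloc k h)

/-- the tail piece is `R` steps followed by the full propagator. [cite: BalabanImbrieJaffe1988, §5.14 p.310] -/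
theorem tailPiece_eq_stepOp_pow_mul (R : ℕ) : tailPiece b A R = stepOp b A ^ R * A⁻¹ := rfl

/-! ## §4  Sizes in the `ℓ^∞`-operator norm -/

/-- `‖C_{loc,R}‖ ≤ (Σ_{k<R} ‖T^k‖)·‖D⁻¹‖`. [cite: BalabanImbrieJaffe1988, §5.14 p.310] -/
theorem norm_locPiece_le (R : ℕ) :
    ‖locPiece b A R‖ ≤ (∑ k ∈ range R, ‖stepOp b A ^ k‖) * ‖(blockDiag b A)⁻¹‖ :=
  (norm_mul_le _ _).trans (mul_le_mul_of_nonneg_right (norm_sum_le _ _) (norm_nonneg _))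

/-- `‖C_{tail,R}‖ ≤ ‖T^R‖·‖A⁻¹‖` — print's *"factor of e^{−cr(e_k)}"* is the smallness of `‖T^R‖`, an input.
[cite: BalabanImbrieJaffe1988, §5.14 p.310] -/
theorem norm_tailPiece_le (R : ℕ) : ‖tailPiece b A R‖ ≤ ‖stepOp b A ^ R‖ * ‖A⁻¹‖ := norm_mul_le _ _

/-- `‖T^k‖ ≤ ‖T‖^k` for `k ≥ 1`. [cite: BalabanImbrieJaffe1988, §5.14 p.310] -/
theorem norm_stepOp_pow_le {k : ℕ} (hk : 0 < k) : ‖stepOp b A ^ k‖ ≤ ‖stepOp b A‖ ^ k := norm_pow_le' _ hk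

end Generic

/-! ## §5  The model of record: the two pieces of `prec⁻¹` -/

section Model

variable {α I : Type} [Fintype α] [DecidableEq α] [Fintype I] [DecidableEq I]
  (blk : α → I) (Δ : Matrix α α ℝ) (W : Finset I)

open BIJ88PolymerRep5134 (corner)
open BIJ88PolymerRep5134Gauss (prec prec_ind_self)

/-- **the covariance pieces of record**: `covSplit R false = C_{loc,R}`, `covSplit R true = C_{tail,R}` of the precision
`prec blk Δ W 1_W = Δ|_W` of the §5.13 law on the region `W`, cubes `blk`.  (Stated with the classical `DecidableEq` of
the site type, as the abstract lane's `A⁻¹` in `BIJ88WalkLocatedDisplay312.located_display_fieldLaw`.)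
[cite: BalabanImbrieJaffe1988, §5.14 p.310] -/
def covSplit (R : ℕ) : Bool → Matrix {x : α // blk x ∈ W} {x : α // blk x ∈ W} ℝ :=
  haveI : DecidableEq {x : α // blk x ∈ W} := fun a b => Classical.propDecidable (a = b)
  fun p => bif p then tailPiece (fun x : {x : α // blk x ∈ W} => blk x.1) (prec blk Δ W (corner ℝ W)) R
    else locPiece (fun x : {x : α // blk x ∈ W} => blk x.1) (prec blk Δ W (corner ℝ W)) R

/-- **`Σ_p covSplit p = prec⁻¹`** — the hypothesis `hCov` of the located display on the law, DISCHARGED (`prec ≻ 0`).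
[cite: BalabanImbrieJaffe1988, §5.14 p.310] -/
theorem sum_covSplit (hPD : (prec blk Δ W (corner ℝ W)).PosDef) (R : ℕ) :
    haveI : DecidableEq {x : α // blk x ∈ W} := fun a b => Classical.propDecidable (a = b)
    ∑ p, covSplit blk Δ W R p = (prec blk Δ W (corner ℝ W))⁻¹ := by
  letI : DecidableEq {x : α // blk x ∈ W} := fun a b => Classical.propDecidable (a = b)
  rw [Fintype.sum_bool]
  simp only [covSplit, cond_true, cond_false]
  rw [add_comm]
  exact locPiece_add_tailPiece_of_posDef hPD R

/-- **THE LOCAL PIECE OF RECORD HAS RANGE `< R` CUBES** under the model's standing locality of `Δ`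
(`Δ x y = 0` unless `blk x = blk y` or `adj (blk x) (blk y)`). [cite: BalabanImbrieJaffe1988, §5.14 p.310] -/
theorem covSplit_false_apply_eq_zero {adj : I → I → Prop} (hPD : (prec blk Δ W (corner ℝ W)).PosDef)
    (hΔ : ∀ x y, blk x ≠ blk y → ¬ adj (blk x) (blk y) → Δ x y = 0) (R : ℕ) {x y : {x : α // blk x ∈ W}}
    (hfar : ∀ k < R, ¬ CubeWalk adj k (blk x.1) (blk y.1)) : covSplit blk Δ W R false x y = 0 := by
  letI : DecidableEq {x : α // blk x ∈ W} := fun a b => Classical.propDecidable (a = b)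
  have hloc : ∀ x y : {x : α // blk x ∈ W}, blk x.1 ≠ blk y.1 → ¬ adj (blk x.1) (blk y.1) →
      prec blk Δ W (corner ℝ W) x y = 0 := fun x y h1 h2 => by
    rw [prec_ind_self]; exact hΔ x.1 y.1 h1 h2
  simp only [covSplit, cond_false]
  exact locPiece_apply_eq_zero (posDef_blockDiag hPD).det_pos.ne'.isUnit hloc R hfar

/-- the tail piece of record is `T^R · prec⁻¹`; its `ℓ^∞`-operator norm is at most `‖T^R‖·‖prec⁻¹‖`.
[cite: BalabanImbrieJaffe1988, §5.14 p.310] -/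
theorem norm_covSplit_true_le (R : ℕ) :
    haveI : DecidableEq {x : α // blk x ∈ W} := fun a b => Classical.propDecidable (a = b)
    ‖covSplit blk Δ W R true‖ ≤
      ‖stepOp (fun x : {x : α // blk x ∈ W} => blk x.1) (prec blk Δ W (corner ℝ W)) ^ R‖
        * ‖(prec blk Δ W (corner ℝ W))⁻¹‖ := by
  letI : DecidableEq {x : α // blk x ∈ W} := fun a b => Classical.propDecidable (a = b)
  simp only [covSplit, cond_true]
  exact norm_tailPiece_le R

end Model

end Literature.MathematicalPhysics.QuantumFieldTheory.BalabanImbrieJaffe1984to88.BIJ88WalkCovarianceSplit310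

end
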